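import Summits.AnomalousDissipation.AnomalousDissipation.Theorems.MomentParityLevelNMeasure

/-! # Route MomentParity · crux `GalerkinEnsembleRealization` — line `Sketch`, stub `stub_levelLaw`

The level-`N` Galerkin ensemble `μ` (a probability measure on `H = Torus.energySpace (Fin 3)`
carried by band-limited fields of the ball `‖u‖ ≤ R` and annihilating the Navier–Stokes generator
on band-limited cylindrical tests) is pushed to the trajectory space
`𝒦 = pathSpace R (pathLip ν A R)`: with `m = (u ↦ û|_{freqBall N})_* μ` the law of the
coefficients and `P = (orbitPathOn)_* m` the law of the orbit paths, we prove that

* `P` is a probability measure (the corestricted orbit map is `m`-a.e. measurable, the good set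
  carrying `m`);
* `P` is invariant under the unit time shift (`map_pathShiftOn_map_orbitPathOn` + invariance of
  `m` under the time-one Galerkin map);
* every open set of positive `P`-measure contains the orbit path of a Galerkin datum of the phase
  space whose orbit is confined to the energy ball (a set of positive `m`-measure meets the
  full-measure set of good, confined data).

Source: Foias–Rosa–Temam 2013 (arXiv:1111.6257), proof of Thm. 3.1; Foias–Manley–Rosa–Temam 2001,
Ch. IV App. B (stmt-AnomalousDissipation-11466). -/

noncomputable section

-- every `Summit.AnomalousDissipation.AnomalousDissipation.…` name repeats the summit = sub-problem segment (D-0017 layout)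
set_option linter.dupNamespace false

open MeasureTheory Set Filter Topology Function Metric UnitAddTorus
open scoped BigOperators ENNReal InnerProductSpace RealInnerProductSpace

namespace Summit.AnomalousDissipation.AnomalousDissipation.Theorems.MomentParity

open Literature.Analysis.FunctionSpaces Literature.Analysis.FunctionSpaces.Torus
open Literature.Analysis.FluidPDE Literature.Analysis.FluidPDE.Torus

variable {ν : ℝ} {f : UnitAddTorus (Fin 3) → EuclideanSpace ℝ (Fin 3)}

/-- **Level law.** The law `P = (orbitPathOn)_* (coeff)_* μ` of the level-`N` ensemble on
`𝒦 = pathSpace R (pathLip ν A R)` is a probability measure, invariant under the unit shift, and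
every open set of positive `P`-measure contains the orbit path of a confined Galerkin orbit. -/
theorem stub_levelLaw (hν : 0 < ν) (hf : IsSmooth f) (hf0 : HasZeroMean f) {N : ℕ} {R A : ℝ}
    (hA : ∀ k, ‖coeffExt (freqBall N) (fourierRestrict (freqBall N) f) k‖ ≤ A) (hA0 : 0 ≤ A)
    (ω₀ : ↥(pathSpace R (pathLip ν A R) : Set (Path (Fin 3))))
    {μ : Measure (Torus.energySpace (Fin 3))} [IsProbabilityMeasure μ]
    (h1 : ∀ᵐ u ∂μ, ∀ k ∉ (freqBall N).erase (0 : Fin 3 → ℤ),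
      mFourierCoeff (EuclideanSpace.complexify ∘ (u.1 : UnitAddTorus (Fin 3) → EuclideanSpace ℝ (Fin 3))) k = 0)
    (h2 : ∀ᵐ u ∂μ, ‖u‖ ≤ R)
    (h4 : ∀ Φ : CylindricalTest (Fin 3),
      (∀ i, ∀ k ∉ (freqBall N).erase (0 : Fin 3 → ℤ),
        mFourierCoeff (EuclideanSpace.complexify ∘ (Φ.g i)) k = 0) →
        Integrable (fun u => nsGeneratorPairing ν f u (Φ.grad u)) μ ∧
          ∫ u, nsGeneratorPairing ν f u (Φ.grad u) ∂μ = 0) :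
    IsProbabilityMeasure ((μ.map fun u : Torus.energySpace (Fin 3) =>
        fourierRestrict (freqBall N) (u.1 : UnitAddTorus (Fin 3) → EuclideanSpace ℝ (Fin 3))).map
        (orbitPathOn ν (fourierRestrict (freqBall N) f) R (pathLip ν A R) ω₀)) ∧
    ((μ.map fun u : Torus.energySpace (Fin 3) =>
        fourierRestrict (freqBall N) (u.1 : UnitAddTorus (Fin 3) → EuclideanSpace ℝ (Fin 3))).map
        (orbitPathOn ν (fourierRestrict (freqBall N) f) R (pathLip ν A R) ω₀)).map
        (pathShiftOn R (pathLip ν A R) (pathShift_mapsTo R (pathLip ν A R))) =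
      (μ.map fun u : Torus.energySpace (Fin 3) =>
        fourierRestrict (freqBall N) (u.1 : UnitAddTorus (Fin 3) → EuclideanSpace ℝ (Fin 3))).map
        (orbitPathOn ν (fourierRestrict (freqBall N) f) R (pathLip ν A R) ω₀) ∧
    ∀ U : Set ↥(pathSpace R (pathLip ν A R) : Set (Path (Fin 3))), IsOpen U →
      0 < ((μ.map fun u : Torus.energySpace (Fin 3) =>
        fourierRestrict (freqBall N) (u.1 : UnitAddTorus (Fin 3) → EuclideanSpace ℝ (Fin 3))).map
        (orbitPathOn ν (fourierRestrict (freqBall N) f) R (pathLip ν A R) ω₀)) U →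
      ∃ c : ↥(freqBall N : Finset (Fin 3 → ℤ)) → EuclideanSpace ℂ (Fin 3),
        c ∈ galerkinSubspace (freqBall N) ∧
        (∀ t, 0 ≤ t → ∑ k ∈ freqBall N, ‖coeffExt (freqBall N)
          (galerkinCoeffFlow ν (fourierRestrict (freqBall N) f) t c) k‖ ^ 2 ≤ R ^ 2) ∧
        ∃ h : orbitPath ν (fourierRestrict (freqBall N) f) c ∈ pathSpace R (pathLip ν A R),
          (⟨orbitPath ν (fourierRestrict (freqBall N) f) c, h⟩ :
            ↥(pathSpace R (pathLip ν A R) : Set (Path (Fin 3)))) ∈ U := by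
  -- abbreviations: the coefficient map `κ`, the force coefficients `gN`
  set κ := fun u : Torus.energySpace (Fin 3) =>
    fourierRestrict (freqBall N) (u.1 : UnitAddTorus (Fin 3) → EuclideanSpace ℝ (Fin 3)) with hκ
  set gN := fourierRestrict (freqBall N) f with hgN
  have hκm : AEMeasurable κ μ := (continuous_fourierRestrict_coe N).measurable.aemeasurable
  haveI hmprob : IsProbabilityMeasure (μ.map κ) := Measure.isProbabilityMeasure_map hκm
  have hg : IsRealCoeff gN := isRealCoeff_mFourierCoeff hf.integrable
  -- the good set carries the law of the coefficients
  have hgood : (μ.map κ) {c | c ∈ galerkinSubspace (freqBall N) ∧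
      orbitPath ν gN c ∈ pathSpace R (pathLip ν A R)}ᶜ = 0 :=
    map_coeff_compl_good_eq_zero hν (hf.memLp 2) hf0 hA hA0 h1 h2 h4
  have hPi : AEMeasurable (orbitPathOn ν gN R (pathLip ν A R) ω₀) (μ.map κ) :=
    aemeasurable_orbitPathOn hν.le hg ω₀ hgood
  refine ⟨Measure.isProbabilityMeasure_map hPi, ?_, fun U hU hPU => ?_⟩
  · -- shift invariance: invariance of `m` under the time-one Galerkin map
    exact map_pathShiftOn_map_orbitPathOn hν.le hg ω₀ hgood
      (map_coeff_invariant hν (hf.memLp 2) hf0 h1 h2 h4 zero_le_one)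
  · -- an open set of positive `P`-measure has a preimage of positive `m`-measure, which meets
    -- the full-measure set of good, confined data
    rw [Measure.map_apply_of_aemeasurable hPi hU.measurableSet] at hPU
    have hae₁ : ∀ᵐ c ∂(μ.map κ), c ∈ {c | c ∈ galerkinSubspace (freqBall N) ∧
        orbitPath ν gN c ∈ pathSpace R (pathLip ν A R)} := by
      rw [ae_iff]; exact hgood
    have hae₂ : ∀ᵐ c ∂(μ.map κ), c ∈ galerkinSubspace (freqBall N) ∧
        ∀ t, 0 ≤ t → ∑ k ∈ freqBall N, ‖coeffExt (freqBall N) (galerkinCoeffFlow ν gN t c) k‖ ^ 2 ≤ R ^ 2 :=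
      map_coeff_ae_confined hν (hf.memLp 2) hf0 h1 h2 h4
    obtain ⟨c, hcU, hcgood, hcconf⟩ := Measure.exists_mem_of_measure_ne_zero_of_ae hPU.ne'
      (ae_restrict_of_ae (hae₁.and hae₂))
    refine ⟨c, hcconf.1, hcconf.2, hcgood.2, ?_⟩
    have heq : orbitPathOn ν gN R (pathLip ν A R) ω₀ c = ⟨orbitPath ν gN c, hcgood.2⟩ :=
      Subtype.ext (coe_orbitPathOn_of_mem ν gN R (pathLip ν A R) ω₀ hcgood.2)
    rw [← heq]
    exact hcU

end Summit.AnomalousDissipation.AnomalousDissipation.Theorems.MomentParity
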